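import Literature.NumberTheory.GaloisRepresentations.AdjointCoefficients
import Literature.NumberTheory.GaloisRepresentations.ContinuousH2
import HarnessLib

/-!
# The cone complex of `ad ρ̄ → ⊕_v ad ρ̄_v / 𝔟_v` in degree `2`: cocycles, coboundaries, classes

Topic `Literature/NumberTheory/GaloisRepresentations`.  The receptacle of the obstruction map
in the relation count for nearly ordinary deformation rings (Böckle 2007, Thm. 7.6, via the
cone/"Selmer-dual" formulation of the global-local obstruction).  Data: a topological group `Γ`
with a representation `r : Γ → GL_n(κ)` (open kernel, `κ` discrete), finitely many topological
groups `G v` with continuous homomorphisms `ι v : G v → Γ`, parabolic-valued representations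
`r_v : G v → P_b(κ)` with open kernels, and frames `N v ∈ GL_n(κ)` (in the application
`r_v = N_v⁻¹ (r ∘ ι_v) N_v`).

* `ConeCochains` — the `κ`-module `(Γ² → M_n) × Π_v (((G v)² → M_n) × (G v → M_n))` of
  matrix-valued cochains (plain functions: quotients of submodules of `C(-, 𝔭)` are not
  available for instance-diamond reasons, so continuity and the shape `c_v ∈ 𝔭_b` are imposed as
  conditions);
* `coneCocycles` — triples `(c, (c_v), (h_v))`, all continuous, with `c`, `c_v` `2`-cocycles
  (for the conjugation actions of `r`, `r_v`), `c_v` valued in `𝔭_b`, and the LINKING identity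
  `r_v(σ) h_v(τ) r_v(σ)⁻¹ - h_v(στ) + h_v(σ) = N_v⁻¹ c(ι σ, ι τ) N_v - c_v(σ, τ)`;
* `IsConeCoboundary`, `coneCoboundaries` — triples of the form
  `(∂a, (∂a_v), (N_v⁻¹ (a ∘ ι_v) N_v - a_v + ∂w_v))`;
* `ConeH2 = coneCocycles / coneCoboundaries`, `coneClass`, and
  `coneClass_eq_zero_iff : coneClass x = 0 ↔ IsConeCoboundary x`.

This is the explicit cochain model of `H²` of the mapping cone of
`C•(Γ, ad) → ⊕_v C•(G v, ad/𝔭_b)`; no spectral sequences or derived categories are used.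
Everything is proved; no named facts.

## References

* G. Böckle, *Presentations of universal deformation rings*, LMS LNS 320 (2007), §5 and
  Thm. 7.6. [cite: Bockle2007Presentations, Theorem 7.6]
* B. Mazur, *Deforming Galois representations*, MSRI Publ. 16 (1989), §1.6.
  [cite: Mazur1989Deforming, §1.6 Prop. 2]
* J. Neukirch, A. Schmidt, K. Wingberg, *Cohomology of Number Fields*, 2nd ed. (2008), I §2
  (cochains). [NeukirchSchmidtWingberg2008]
-/

noncomputable section

open Topology

namespace Literature.NumberTheory.GaloisRepresentations

namespace LiftingObstruction

open Matrix

section Cone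

variable {n : Type} [Fintype n] [DecidableEq n] {κ : Type} [CommRing κ] [TopologicalSpace κ]
  [DiscreteTopology κ] {Γ : Type} [Group Γ] [TopologicalSpace Γ]
  (r : Γ →* GL n κ)
  {V : Type} (G : V → Type) [∀ v, Group (G v)] [∀ v, TopologicalSpace (G v)]
  (ι : ∀ v, G v →* Γ) (rv : ∀ v, G v →* GL n κ)
  {α : Type} [LinearOrder α] (b : n → α) (N : V → GL n κ)

/-! ## 1. Cochains with values in `M_n(κ)` -/

/-- The inhomogeneous `2`-cocycle identity for a matrix-valued function `f : H × H → M_n(κ)`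
and a homomorphism `ρ : H → GL_n(κ)` acting by conjugation:
`ρ(σ) f(τ, υ) ρ(σ)⁻¹ + f(σ, τυ) = f(στ, υ) + f(σ, τ)`. [folklore] -/
def IsTwoCocycleFn {H : Type*} [Group H] (ρ : H →* GL n κ) (f : H × H → Matrix n n κ) : Prop :=
  ∀ σ τ υ : H, conjLin (ρ σ) (f (τ, υ)) + f (σ, τ * υ) = f (σ * τ, υ) + f (σ, τ)

omit [TopologicalSpace κ] [DiscreteTopology κ] in
/-- The `2`-cocycle identity is additive. [folklore] -/
theorem IsTwoCocycleFn.add {H : Type*} [Group H] {ρ : H →* GL n κ} {f g : H × H → Matrix n n κ}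
    (hf : IsTwoCocycleFn ρ f) (hg : IsTwoCocycleFn ρ g) : IsTwoCocycleFn ρ (f + g) := fun σ τ υ => by
  simp only [Pi.add_apply, map_add]
  rw [add_add_add_comm, hf σ τ υ, hg σ τ υ, add_add_add_comm]

omit [TopologicalSpace κ] [DiscreteTopology κ] in
/-- The `2`-cocycle identity is homogeneous. [folklore] -/
theorem IsTwoCocycleFn.smul {H : Type*} [Group H] {ρ : H →* GL n κ} {f : H × H → Matrix n n κ}
    (hf : IsTwoCocycleFn ρ f) (c : κ) : IsTwoCocycleFn ρ (c • f) := fun σ τ υ => by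
  simp only [Pi.smul_apply, map_smul, ← smul_add, hf σ τ υ]

omit [TopologicalSpace κ] [DiscreteTopology κ] in
/-- The zero function is a `2`-cocycle. [folklore] -/
theorem IsTwoCocycleFn.zero {H : Type*} [Group H] (ρ : H →* GL n κ) :
    IsTwoCocycleFn ρ (0 : H × H → Matrix n n κ) := fun σ τ υ => by simp

omit [Fintype n] [DecidableEq n] [TopologicalSpace κ] [DiscreteTopology κ] in
/-- Block-triangular matrices are stable under scalars. [folklore] -/
theorem blockTriangular_smul' {M : Matrix n n κ} (hM : M.BlockTriangular b) (c : κ) :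
    (c • M).BlockTriangular b := fun i j hij => by
  rw [Matrix.smul_apply, hM hij, smul_zero]

/-! ## 2. Cone cochains and cone cocycles -/

/-- **Cone `2`-cochains** (as plain matrix-valued functions; continuity, the parabolic shape of
the local components and the cocycle identities are imposed in `coneCocycles`):
`(Γ² → M_n) × Π_v (((G v)² → M_n) × (G v → M_n))`. [cite: Bockle2007Presentations, Theorem 7.6] -/
abbrev ConeCochains (n κ Γ : Type) {V : Type} (G : V → Type) : Type :=
  (Γ × Γ → Matrix n n κ) × (∀ v : V, (G v × G v → Matrix n n κ) × (G v → Matrix n n κ))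

/-- The LINKING identity for a cone cochain at `v`:
`r_v(σ) h(τ) r_v(σ)⁻¹ - h(στ) + h(σ) = N_v⁻¹ c(ισ, ιτ) N_v - c_v(σ, τ)`.
[cite: Bockle2007Presentations, Theorem 7.6] -/
def ConeLink (x : ConeCochains n κ Γ G) (v : V) : Prop :=
  ∀ σ τ : G v,
    conjLin (rv v σ) ((x.2 v).2 τ) - (x.2 v).2 (σ * τ) + (x.2 v).2 σ =
      conjLin (N v)⁻¹ (x.1 (ι v σ, ι v τ)) - (x.2 v).1 (σ, τ)

/-- **Cone `2`-cocycles**: all components continuous, the local `2`-cochains `c_v` take values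
in `𝔭_b`, `c` and all `c_v` are `2`-cocycles, and the linking identities hold.
[cite: Bockle2007Presentations, Theorem 7.6] -/
def coneCocycles : Submodule κ (ConeCochains n κ Γ G) where
  carrier := {x | Continuous x.1 ∧ IsTwoCocycleFn r x.1 ∧
    ∀ v, Continuous (x.2 v).1 ∧ Continuous (x.2 v).2 ∧ (∀ στ, ((x.2 v).1 στ).BlockTriangular b) ∧
      IsTwoCocycleFn (rv v) (x.2 v).1 ∧ ConeLink G ι rv N x v}
  zero_mem' := ⟨continuous_const, IsTwoCocycleFn.zero _, fun v =>
    ⟨continuous_const, continuous_const, fun _ => Matrix.blockTriangular_zero,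
      IsTwoCocycleFn.zero _, fun σ τ => by simp⟩⟩
  add_mem' {x y} hx hy := ⟨hx.1.add hy.1, hx.2.1.add hy.2.1, fun v =>
    ⟨(hx.2.2 v).1.add (hy.2.2 v).1, (hx.2.2 v).2.1.add (hy.2.2 v).2.1,
      fun στ => ((hx.2.2 v).2.2.1 στ).add ((hy.2.2 v).2.2.1 στ),
      (hx.2.2 v).2.2.2.1.add (hy.2.2 v).2.2.2.1, fun σ τ => by
      have h1 := (hx.2.2 v).2.2.2.2 σ τ
      have h2 := (hy.2.2 v).2.2.2.2 σ τ
      simp only [Prod.snd_add, Prod.fst_add, Pi.add_apply, map_add]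
      calc _ = (conjLin (rv v σ) ((x.2 v).2 τ) - (x.2 v).2 (σ * τ) + (x.2 v).2 σ) +
            (conjLin (rv v σ) ((y.2 v).2 τ) - (y.2 v).2 (σ * τ) + (y.2 v).2 σ) := by abel
        _ = (conjLin (N v)⁻¹ (x.1 (ι v σ, ι v τ)) - (x.2 v).1 (σ, τ)) +
            (conjLin (N v)⁻¹ (y.1 (ι v σ, ι v τ)) - (y.2 v).1 (σ, τ)) := by rw [h1, h2]
        _ = _ := by abel⟩⟩
  smul_mem' c x hx := ⟨hx.1.const_smul c, hx.2.1.smul c, fun v =>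
    ⟨(hx.2.2 v).1.const_smul c, (hx.2.2 v).2.1.const_smul c,
      fun στ => blockTriangular_smul' b ((hx.2.2 v).2.2.1 στ) c, (hx.2.2 v).2.2.2.1.smul c,
      fun σ τ => by
      have h1 := congrArg (c • ·) ((hx.2.2 v).2.2.2.2 σ τ)
      simp only [smul_sub, smul_add] at h1
      simpa only [Prod.smul_snd, Prod.smul_fst, Pi.smul_apply, map_smul] using h1⟩⟩

variable {r G ι rv b N} in
/-- Membership in `coneCocycles`. [folklore] -/
theorem mem_coneCocycles_iff (x : ConeCochains n κ Γ G) :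
    x ∈ coneCocycles r G ι rv b N ↔
      Continuous x.1 ∧ IsTwoCocycleFn r x.1 ∧
        ∀ v, Continuous (x.2 v).1 ∧ Continuous (x.2 v).2 ∧
          (∀ στ, ((x.2 v).1 στ).BlockTriangular b) ∧
          IsTwoCocycleFn (rv v) (x.2 v).1 ∧ ConeLink G ι rv N x v :=
  Iff.rfl

/-! ## 3. Cone coboundaries and the cone `H²` -/

/-- **Cone `2`-coboundaries**: `x = (∂a, (∂a_v)_v, (N_v⁻¹ a(ι ·) N_v - a_v + ∂w_v)_v)` for
continuous `1`-cochains `a` (valued in `M_n`) and `a_v` (valued in `𝔭_b`) and `0`-cochains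
`w_v ∈ M_n`. [cite: Bockle2007Presentations, Theorem 7.6] -/
def IsConeCoboundary (x : ConeCochains n κ Γ G) : Prop :=
  ∃ (a : Γ → Matrix n n κ) (_ : Continuous a)
    (av : ∀ v, G v → Matrix n n κ) (_ : ∀ v, Continuous (av v))
    (_ : ∀ v σ, (av v σ).BlockTriangular b) (w : V → Matrix n n κ),
    (∀ σ τ, x.1 (σ, τ) = conjLin (r σ) (a τ) - a (σ * τ) + a σ) ∧
    ∀ v, (∀ σ τ, (x.2 v).1 (σ, τ) = conjLin (rv v σ) (av v τ) - av v (σ * τ) + av v σ) ∧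
      ∀ σ, (x.2 v).2 σ = conjLin (N v)⁻¹ (a (ι v σ)) - av v σ + (conjLin (rv v σ) (w v) - w v)

/-- The submodule of cone coboundaries. [cite: Bockle2007Presentations, Theorem 7.6] -/
def coneCoboundaries : Submodule κ (ConeCochains n κ Γ G) where
  carrier := {x | IsConeCoboundary r G ι rv b N x}
  zero_mem' := ⟨0, continuous_const, fun _ => 0, fun _ => continuous_const,
    fun _ _ => Matrix.blockTriangular_zero, fun _ => 0,
    fun σ τ => by simp, fun v => ⟨fun σ τ => by simp, fun σ => by simp⟩⟩
  add_mem' {x y} hx hy := by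
    obtain ⟨a, hac, av, havc, havP, w, ha, hv⟩ := hx
    obtain ⟨a', hac', av', havc', havP', w', ha', hv'⟩ := hy
    refine ⟨a + a', hac.add hac', fun v => av v + av' v, fun v => (havc v).add (havc' v),
      fun v σ => (havP v σ).add (havP' v σ), fun v => w v + w' v, fun σ τ => ?_,
      fun v => ⟨fun σ τ => ?_, fun σ => ?_⟩⟩
    · simp only [Prod.fst_add, Pi.add_apply, ha, ha', map_add]
      abel
    · simp only [Prod.snd_add, Pi.add_apply, Prod.fst_add, (hv v).1, (hv' v).1, map_add]
      abel
    · simp only [Prod.snd_add, Pi.add_apply, (hv v).2, (hv' v).2, map_add]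
      abel
  smul_mem' c x hx := by
    obtain ⟨a, hac, av, havc, havP, w, ha, hv⟩ := hx
    refine ⟨c • a, hac.const_smul c, fun v => c • av v, fun v => (havc v).const_smul c,
      fun v σ => blockTriangular_smul' b (havP v σ) c, fun v => c • w v, fun σ τ => ?_,
      fun v => ⟨fun σ τ => ?_, fun σ => ?_⟩⟩
    · simp only [Prod.smul_fst, Pi.smul_apply, ha, map_smul, smul_sub, smul_add]
    · simp only [Prod.smul_snd, Pi.smul_apply, Prod.smul_fst, (hv v).1, map_smul, smul_sub, smul_add]
    · simp only [Prod.smul_snd, Pi.smul_apply, (hv v).2, map_smul, smul_sub, smul_add]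

variable {r G ι rv b N} in
/-- Membership in `coneCoboundaries`. [folklore] -/
theorem mem_coneCoboundaries_iff (x : ConeCochains n κ Γ G) :
    x ∈ coneCoboundaries r G ι rv b N ↔ IsConeCoboundary r G ι rv b N x :=
  Iff.rfl

/-- **The cone `H²`**: cone cocycles modulo cone coboundaries (the latter cut back to the
cocycles). [cite: Bockle2007Presentations, Theorem 7.6] -/
abbrev ConeH2 : Type :=
  ↥(coneCocycles r G ι rv b N) ⧸
    (coneCoboundaries r G ι rv b N).comap (coneCocycles r G ι rv b N).subtype

/-- The class of a cone cocycle. [folklore] -/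
def coneClass (x : coneCocycles r G ι rv b N) : ConeH2 r G ι rv b N :=
  Submodule.Quotient.mk x

/-- `coneClass` is the quotient map (a linear map). [folklore] -/
def coneClassₗ : ↥(coneCocycles r G ι rv b N) →ₗ[κ] ConeH2 r G ι rv b N :=
  Submodule.mkQ _

/-- `coneClassₗ x = coneClass x`. [folklore] -/
@[simp] theorem coneClassₗ_apply (x : coneCocycles r G ι rv b N) :
    coneClassₗ r G ι rv b N x = coneClass r G ι rv b N x :=
  rfl

/-- **A cone class vanishes iff the cocycle is a cone coboundary.**
[cite: Bockle2007Presentations, Theorem 7.6] -/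
theorem coneClass_eq_zero_iff (x : coneCocycles r G ι rv b N) :
    coneClass r G ι rv b N x = 0 ↔ IsConeCoboundary r G ι rv b N (x : ConeCochains n κ Γ G) := by
  rw [coneClass, Submodule.Quotient.mk_eq_zero, Submodule.mem_comap, Submodule.subtype_apply,
    mem_coneCoboundaries_iff]

end Cone

end LiftingObstruction

end Literature.NumberTheory.GaloisRepresentations
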